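import Literature.NumberTheory.Sieve.LinearEquationsInPrimesThreeForms
import Literature.NumberTheory.Sieve.LinearEquationsInPrimesLevelOne
import Literature.NumberTheory.Sieve.ClusterComplexity
import HarnessLib

/-!
# Lemma 4.4 of Green–Tao 2010 at the true Cauchy–Schwarz complexity; the Main Theorem for all systems of complexity at most one (unconditional)

Topic `Literature/NumberTheory/Sieve`. Proved theorems over the vocabulary of
`LinearEquationsInPrimes.lean` (`AffLinForm d`, `IsNondegenerateSystem`, `affLinSize`,
`vonMangoldtSum`, `archFactor`, `singularProduct`), `LinearEquationsInPrimesNormalForm.lean`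
(`IsNormalForm s`, `GreenTao2010_mainNormalFormAt s` = Thm. 4.5 at level `s`) and
`ClusterComplexity.lean` (`complexity Ψ : ℕ∞`, Def. 1.5), plus ONE definition: the restriction
`GreenTao2010_mainTheoremAtComplexity s` of the Main Theorem (Thm. 1.2, finite-complexity case)
to systems of complexity `≤ s`.

So far the tree proved the normal form extension of Lemma 4.4 only through the trivial cover by
singletons (`GreenTao2010_existsNormalFormExtension`: a `(t − 2)`-normal form, Lemma 1.6), so that
the proved level `s = 1` of Thm. 4.5 (`GreenTao2010_mainNormalFormAt_one`) reached only systems of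
`t ≤ 3` forms (`GreenTao2010_mainTheorem_of_le_three`). Here Lemma 4.4 is proved AS PRINTED, at the
complexity of the system ("Let `Ψ` be a system of affine-linear forms of complexity at most `s` …
Then there exists an extension `Ψ'` … in `s`-normal form", arXiv:math/0606088 p. 13): for each `i`
take the `s + 1` classes `A_{i,1}, …, A_{i,s+1}` of Def. 1.5 and integer witnesses `f_{i,k}` with
`ψ̇ⱼ(f_{i,k}) = 0` for `j ∈ A_{i,k}` and `ψ̇ᵢ(f_{i,k}) ≠ 0`
(`not_memAffLinSpan_iff_exists_witness`), adjoin one new variable `m_{i,k}` per pair `(i, k)` and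
set `Ψ'(n, m) := Ψ(n + ∑ m_{i,k} f_{i,k})` (`AffLinForm.extendAlong`); `Jᵢ := {m_{i,k} : k}`
witnesses the `s`-normal form. The entries of the witnesses are bounded UNIFORMLY in terms of
`d, t, s, L` because they may be chosen as a function of the coefficient pattern
`(ψ̇ᵢ(eⱼ))_{i,j} ∈ [−L, L]^{t × d}`, a finite set ("`‖Ψ'‖_{N'} = O_{d,t,L}(1)`", loc. cit.).

Consequences (the printed "Proof of the Main Theorem assuming Theorem 4.5", §4, verbatim the
tree's `GreenTao2010_main_of_mainNormalFormAt` with `t²` new variables replaced by `t(s+1)` and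
the entry bound `2L` by the uniform bound `M(d,t,s,L)`):

* `GreenTao2010_mainTheoremAtComplexity_of_mainNormalFormAt` — Thm. 4.5 at level `s` gives the
  Main Theorem for ALL systems of complexity `≤ s` (any number `t` of forms);
* `GreenTao2010_mainTheoremAtComplexity_one` — **unconditionally (in this tree), the generalised
  Hardy–Littlewood asymptotic `∑_{n ∈ K ∩ ℤ^d} ∏ᵢ Λ(ψᵢ(n)) = β_∞ ∏_p β_p + o(N^d)` holds for every
  nondegenerate system of affine-linear forms of Cauchy–Schwarz complexity at most `1`**, in any
  number of variables and forms: e.g. Balog's systems `(nᵢ + nⱼ + 1)_{1 ≤ i ≤ j ≤ d}`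
  (`t = d(d+1)/2`, Example 4 of Green–Tao 2010: "`d`-tuples of odd primes all of whose midpoints
  are also prime"), two-dimensional cubes `(n₁, n₁ + n₂, n₁ + n₃, n₁ + n₂ + n₃)` (Example 2 with
  `d = 3`), one non-degenerate linear equation in `t ≥ 3` prime unknowns — the classical domain of
  the Hardy–Littlewood circle method ("For systems of complexity 1, the conjecture can be treated by
  the Hardy–Littlewood circle method (see e.g. [Balog])", Green–Tao 2010, p. 6), obtained here
  through Green–Tao's transference at `s = 1` instead;
* `GreenTao2010_mainTheoremAtComplexity_of_gowersUniformityAt` — for `s ≥ 2` the level-`s`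
  statement is reduced to Thm. 7.2 at level `s` alone (`GreenTao2010_gowersUniformityAt s`);
* `greenTaoZiegler2012_finiteComplexity_iff_forall_mainTheoremAtComplexity` — the family over all
  `s` is exactly the finite-complexity Main Theorem `GreenTaoZiegler2012_finiteComplexity`
  (Lemma 1.6: complexity `≤ t − 2`), and `GeneralizedHardyLittlewood` implies every level
  (on-path certificates).

## References

* [GreenTao2010] B. Green, T. Tao, *Linear equations in primes*, Ann. of Math. 171 (2010),
  1753–1850 (arXiv:math/0606088): Def. 1.5, Lemma 1.6, Examples 2 and 4, p. 6 (complexity `≤ 1`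
  and the circle method), §4 (Def. 4.2, Lemma 4.4 with its proof, Thm. 4.5, "Proof of the Main
  Theorem assuming Theorem 4.5").
* [Balog1992] A. Balog, *Linear equations in primes*, Mathematika 39 (1992), 367–378 (the reference
  [balog-cite] of Green–Tao 2010); A. Balog, *The prime k-tuplets conjecture on average*, in
  Analytic Number Theory (Allerton Park 1989), Progr. Math. 85, Birkhäuser 1990, 47–75 ([Balog]).
-/

noncomputable section

open Filter Finset MeasureTheory
open scoped Topology

namespace Literature.NumberTheory.Sieve

variable {d t : ℕ}

/-! ### Lemma 4.4 at the true complexity -/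

/-- Being in `s`-normal form after extending along `f` depends on the system only through its
linear coefficients (the coefficients of `ψ.extendAlong f` are `ψ̇(eⱼ)` and `ψ̇(f_l)`).
[cite: GreenTao2010, Def. 4.2 and proof of Lemma 4.4] -/
theorem isNormalForm_extendAlong_congr {s k : ℕ} {Ψ Φ : Fin t → AffLinForm d}
    (h : ∀ i j, (Ψ i).coeff j = (Φ i).coeff j) (f : Fin k → Fin d → ℤ)
    (hΨ : IsNormalForm s fun i => (Ψ i).extendAlong f) :
    IsNormalForm s fun i => (Φ i).extendAlong f := by
  have hc : ∀ i e, ((Φ i).extendAlong f).coeff e = ((Ψ i).extendAlong f).coeff e := by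
    intro i e
    induction e using Fin.addCases with
    | left j => simp [h i j]
    | right l => simp [AffLinForm.linearPart, h i]
  intro i
  obtain ⟨J, hJ, h1, h2⟩ := hΨ i
  refine ⟨J, hJ, ?_, fun i' hi' => ?_⟩
  · rwa [Finset.prod_congr rfl fun e _ => hc i e]
  · rw [Finset.prod_congr rfl fun e _ => hc i' e]
    exact h2 i' hi'

/-- **Lemma 4.4 of Green–Tao 2010 at the complexity of the system** (existence, no size bound):
a system `Ψ` of complexity `≤ s` has an extension `Ψ'(n, m) = Ψ(n + ∑_{(i,k)} m_{i,k} f_{i,k})` on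
`ℤ^{d + t(s+1)}` in `s`-normal form. Proof as printed: for each `i` the classes
`A_{i,1}, …, A_{i,s+1}` of Def. 1.5 cover `{ψⱼ : j ≠ i}` and `ψᵢ` is in the affine-linear span of
none of them, so ("by duality", here `not_memAffLinSpan_iff_exists_witness`) there are integer
vectors `f_{i,k}` with `ψ̇ⱼ(f_{i,k}) = 0` for `j ∈ A_{i,k}` and `ψ̇ᵢ(f_{i,k}) ≠ 0`; the new
coordinates `Jᵢ := {m_{i,k} : k ≤ s + 1}` satisfy `∏_{e ∈ Jᵢ} ψ̇'ᵢ(e) = ∏ₖ ψ̇ᵢ(f_{i,k}) ≠ 0` and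
`∏_{e ∈ Jᵢ} ψ̇'ⱼ(e) = 0` for `j ≠ i` (some `A_{i,k} ∋ j`). [cite: GreenTao2010, Lemma 4.4] -/
theorem exists_isNormalForm_extendAlong_of_complexity_le {s : ℕ} (Ψ : Fin t → AffLinForm d)
    (hc : complexity Ψ ≤ s) :
    ∃ f : Fin (t * (s + 1)) → Fin d → ℤ, IsNormalForm s fun i => (Ψ i).extendAlong f := by
  classical
  have hci : ∀ i, ∃ A : Fin (s + 1) → Finset (Fin t),
      (∀ j, j ≠ i → ∃ k, j ∈ A k) ∧ ∀ k, ¬ MemAffLinSpan Ψ i (A k) :=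
    complexity_le_coe_iff.mp hc
  choose A hAcov hAspan using hci
  have hw : ∀ i k, ∃ g : Fin d → ℤ,
      (∀ j ∈ A i k, (Ψ j).linearPart g = 0) ∧ (Ψ i).linearPart g ≠ 0 :=
    fun i k => not_memAffLinSpan_iff_exists_witness.mp (hAspan i k)
  choose g hg0 hg1 using hw
  let e : Fin t × Fin (s + 1) ≃ Fin (t * (s + 1)) := finProdFinEquiv
  let f : Fin (t * (s + 1)) → Fin d → ℤ := fun l => g (e.symm l).1 (e.symm l).2
  have hf : ∀ i k, f (e (i, k)) = g i k := fun i k => by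
    simp only [f, Equiv.symm_apply_apply]
  refine ⟨f, fun i => ⟨(Finset.univ : Finset (Fin (s + 1))).image
    fun k => Fin.natAdd d (e (i, k)), ?_, ?_, ?_⟩⟩
  · exact Finset.card_image_le.trans (by simp)
  · rw [Finset.prod_image]
    · refine Finset.prod_ne_zero_iff.mpr fun k _ => ?_
      rw [AffLinForm.extendAlong_coeff_natAdd, hf]
      exact hg1 i k
    · intro k _ k' _ h
      have h1 : e (i, k) = e (i, k') := (Fin.natAdd_inj d).mp h
      simpa using e.injective h1
  · intro i' hi'
    obtain ⟨k, hk⟩ := hAcov i i' hi'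
    refine Finset.prod_eq_zero (Finset.mem_image.mpr ⟨k, Finset.mem_univ _, rfl⟩) ?_
    rw [AffLinForm.extendAlong_coeff_natAdd, hf]
    exact hg0 i k i' hk

/-- **Lemma 4.4 of Green–Tao 2010 at the complexity of the system, with the size bound**
("if the original system `Ψ` had size `‖Ψ‖_N = O(1)`, then the same is true of the extended system
`Ψ'`, thus `‖Ψ'‖_{N'} = O_{d,t,L}(1)`"): there is `M = M(d, t, s, L)` such that every system of `t`
forms in `d` variables of complexity `≤ s` with coefficients `|ψ̇ᵢ(eⱼ)| ≤ L` has an extension along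
`t(s+1)` integer vectors with entries `≤ M` which is in `s`-normal form. (The witnesses of
`exists_isNormalForm_extendAlong_of_complexity_le` may be chosen as a function of the coefficient
pattern `(ψ̇ᵢ(eⱼ)) ∈ [−L, L]^{t × d}`, a finite set, since both the complexity and the normal form
of the extension depend only on it; `M` is the maximum over the patterns.)
[cite: GreenTao2010, Lemma 4.4] -/
theorem GreenTao2010_existsNormalFormExtension_of_complexity_le (d t s L : ℕ) :
    ∃ M : ℕ, ∀ Ψ : Fin t → AffLinForm d, complexity Ψ ≤ s →
      (∀ i j, ((Ψ i).coeff j).natAbs ≤ L) →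
      ∃ f : Fin (t * (s + 1)) → Fin d → ℤ, (∀ l j, (f l j).natAbs ≤ M) ∧
        IsNormalForm s fun i => (Ψ i).extendAlong f := by
  classical
  have key : ∀ a : Fin t → Fin d → ℤ, ∃ M : ℕ, ∀ Ψ : Fin t → AffLinForm d,
      (∀ i j, (Ψ i).coeff j = a i j) → complexity Ψ ≤ s →
      ∃ f : Fin (t * (s + 1)) → Fin d → ℤ, (∀ l j, (f l j).natAbs ≤ M) ∧
        IsNormalForm s fun i => (Ψ i).extendAlong f := by
    intro a
    by_cases h : ∃ Φ : Fin t → AffLinForm d, (∀ i j, (Φ i).coeff j = a i j) ∧ complexity Φ ≤ s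
    · obtain ⟨Φ, hΦa, hΦc⟩ := h
      obtain ⟨f, hf⟩ := exists_isNormalForm_extendAlong_of_complexity_le Φ hΦc
      refine ⟨Finset.univ.sup fun lj : Fin (t * (s + 1)) × Fin d => (f lj.1 lj.2).natAbs,
        fun Ψ hΨa _ => ⟨f, fun l j => ?_, ?_⟩⟩
      · exact Finset.le_sup (f := fun lj : Fin (t * (s + 1)) × Fin d => (f lj.1 lj.2).natAbs)
          (Finset.mem_univ (l, j))
      · exact isNormalForm_extendAlong_congr (fun i j => by rw [hΦa, hΨa]) f hf
    · exact ⟨0, fun Ψ hΨa hΨc => absurd ⟨Ψ, hΨa, hΨc⟩ h⟩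
  choose M hM using key
  refine ⟨(Fintype.piFinset fun _ : Fin t =>
      Fintype.piFinset fun _ : Fin d => Finset.Icc (-(L : ℤ)) L).sup M, fun Ψ hc hL => ?_⟩
  have hmem : (fun i j => (Ψ i).coeff j) ∈ Fintype.piFinset fun _ : Fin t =>
      Fintype.piFinset fun _ : Fin d => Finset.Icc (-(L : ℤ)) L := by
    refine Fintype.mem_piFinset.mpr fun i => Fintype.mem_piFinset.mpr fun j => ?_
    rw [Finset.mem_Icc]
    have h1 : |(Ψ i).coeff j| ≤ (L : ℤ) := by
      rw [← Int.natCast_natAbs]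
      exact_mod_cast hL i j
    exact abs_le.mp h1
  obtain ⟨f, hfM, hnf⟩ := hM (fun i j => (Ψ i).coeff j) Ψ (fun i j => rfl) hc
  exact ⟨f, fun l j => (hfM l j).trans (Finset.le_sup (f := M) hmem), hnf⟩

/-! ### The Main Theorem restricted to a complexity level -/

/-- **The Main Theorem of Green–Tao 2010 for systems of complexity at most `s`** (Thm. 1.2 in the
finite-complexity case, restricted by Def. 1.5): for every `d ≥ 1`, `t ≥ 1`, `L` and `ε > 0` there
is `N₀` such that for `N ≥ N₀`, every nondegenerate system `Ψ` of `t` affine-linear forms in `d`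
variables of complexity `≤ s` with `‖Ψ‖_N ≤ L` and every convex `K ⊆ [−N, N]^d`,
`|∑_{n ∈ K ∩ ℤ^d} ∏ᵢ Λ(ψᵢ(n)) − β_∞ ∏_p β_p| ≤ ε N^d`. A THEOREM in print for every `s`
(Green–Tao 2010 together with `GI(s)` and `MN(s)`); kernel status: proved below for `s ≤ 1`
(`GreenTao2010_mainTheoremAtComplexity_one`), reduced to `GreenTao2010_gowersUniformityAt s` for
`s ≥ 2`, and for all `s` together equivalent to `GreenTaoZiegler2012_finiteComplexity`.
[cite: GreenTao2010, Main Theorem (Thm. 1.2, finite complexity) and Def. 1.5] -/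
def GreenTao2010_mainTheoremAtComplexity (s : ℕ) : Prop :=
  ∀ (d t L : ℕ), 1 ≤ d → 1 ≤ t → ∀ ε : ℝ, 0 < ε → ∃ N₀ : ℕ, ∀ N : ℕ, N₀ ≤ N →
    ∀ Ψ : Fin t → AffLinForm d, IsNondegenerateSystem Ψ → complexity Ψ ≤ s →
      affLinSize Ψ N ≤ L →
      ∀ K : Set (Fin d → ℝ), Convex ℝ K → K ⊆ realBox d N →
        |vonMangoldtSum Ψ K N - archFactor Ψ K * singularProduct Ψ| ≤ ε * (N : ℝ) ^ d

/-- The levels are nested: complexity `≤ s ≤ s'`. [cite: GreenTao2010, Def. 1.5] -/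
theorem GreenTao2010_mainTheoremAtComplexity.anti {s s' : ℕ} (hss' : s ≤ s')
    (h : GreenTao2010_mainTheoremAtComplexity s') : GreenTao2010_mainTheoremAtComplexity s := by
  intro d t L hd ht ε hε
  obtain ⟨N₀, hN₀⟩ := h d t L hd ht ε hε
  exact ⟨N₀, fun N hN Ψ hΨ hc hL K hK hKN =>
    hN₀ N hN Ψ hΨ (hc.trans (by exact_mod_cast hss')) hL K hK hKN⟩

/-- **§4 of Green–Tao 2010 at level `s`, for all systems of complexity `≤ s`**: Thm. 4.5 at level
`s` implies the Main Theorem for every nondegenerate system of complexity at most `s`, with any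
number `t` of forms (elimination of the archimedean factor, the normal form extension of Lemma 4.4
AT COMPLEXITY `s` (`GreenTao2010_existsNormalFormExtension_of_complexity_le`: `t(s+1)` new variables,
entries `≤ M(d,t,s,L)`), Thm. 4.5 at scale `N' = (1 + t(s+1)M)N`, change of variables and division
by `(2N+1)^{t(s+1)}`). Proof verbatim that of `GreenTao2010_main_of_mainNormalFormAt`.
[cite: GreenTao2010, §4 (Lemma 4.4 and "Proof of the Main Theorem assuming Theorem 4.5")] -/
theorem GreenTao2010_mainTheoremAtComplexity_of_mainNormalFormAt {s : ℕ}
    (hNF : GreenTao2010_mainNormalFormAt s) : GreenTao2010_mainTheoremAtComplexity s := by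
  intro d t L hd ht ε hε
  classical
  -- the uniform witness bound of Lemma 4.4 at complexity `s`
  obtain ⟨M, hM⟩ := GreenTao2010_existsNormalFormExtension_of_complexity_le d t s L
  -- constants depending only on `d, t, s, L` (and `ε`); `k = t(s+1)` new variables
  obtain ⟨C, hC⟩ : ∃ C : ℕ, C = 1 + t * (s + 1) * M := ⟨_, rfl⟩
  obtain ⟨L', hL'⟩ : ∃ L' : ℕ, L' = t * (d + t * (s + 1)) * (L + d * L * M) + L := ⟨_, rfl⟩
  obtain ⟨B, hB0, hB⟩ := singularProduct_mem_Icc_uniform t L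
  obtain ⟨Cd, hCd⟩ := GreenTao2010_latticePointsConvexBody_holds d hd
  have hC1 : 1 ≤ C := by rw [hC]; exact Nat.le_add_right 1 _
  have hCr1 : (1 : ℝ) ≤ C := by exact_mod_cast hC1
  have hCr0 : (0 : ℝ) < C := by linarith
  have hε' : 0 < ε / (4 * (C : ℝ) ^ (d + t * (s + 1))) := by positivity
  obtain ⟨N₁, hN₁⟩ := hNF (d + t * (s + 1)) t L' (le_trans hd (Nat.le_add_right d _)) ht _ hε'
  obtain ⟨A, hA⟩ : ∃ A : ℝ, A = (C : ℝ) + t * (1 + B) + |Cd| * B + 1 := ⟨_, rfl⟩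
  have htB0 : 0 ≤ (t : ℝ) * (1 + B) := by positivity
  have hCdB0 : 0 ≤ |Cd| * B := by positivity
  have hA1 : 1 ≤ A := by rw [hA]; linarith
  have hA0 : 0 ≤ A := by linarith
  have hCA : (C : ℝ) ≤ A := by rw [hA]; linarith
  have htA : (t : ℝ) * (1 + B) ≤ A := by rw [hA]; linarith
  have hCdA : |Cd| * B ≤ A := by rw [hA]; linarith
  have hL₁ : (1 : ℝ) ≤ max (L : ℝ) 1 := le_max_right _ _
  obtain ⟨N₂, hN₂⟩ := slab_error_eventually hA1 hL₁ (by positivity : 0 < ε / 4) d t hd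
  refine ⟨max N₁ (max N₂ 1), fun N hN Ψ hΨ hc hL K hK hKN => ?_⟩
  have hN₁N : N₁ ≤ N := le_trans (le_max_left _ _) hN
  have hN₂N : N₂ ≤ N := le_trans ((le_max_left _ _).trans (le_max_right _ _)) hN
  have hN1 : 1 ≤ N := le_trans ((le_max_right _ _).trans (le_max_right _ _)) hN
  have hNr1 : (1 : ℝ) ≤ N := by exact_mod_cast hN1
  have hNr0 : (0 : ℝ) < N := by linarith
  -- finite complexity (Lemma 1.6), coefficient bound, the normal form extension (Lemma 4.4)
  have hfc : IsFiniteComplexitySystem Ψ :=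
    (isFiniteComplexitySystem_of_complexity_ne_top (ne_top_of_le_ne_top (ENat.coe_ne_top s) hc)).1
  have hcoef : ∀ i j, ((Ψ i).coeff j).natAbs ≤ L := fun i j =>
    natAbs_coeff_le_of_affLinSize_le hL i j
  obtain ⟨f, hfM, hnf⟩ := hM Ψ hc hcoef
  -- the singular product is bounded
  obtain ⟨hS0, hSB⟩ := hB d Ψ hΨ hfc hcoef
  -- the scale `N' = C N` and the threshold `H = ⌈N'^{8/10}⌉`
  obtain ⟨N', hN'⟩ : ∃ N' : ℕ, N' = C * N := ⟨_, rfl⟩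
  have hNN' : N ≤ N' := by rw [hN']; exact Nat.le_mul_of_pos_left N (by omega)
  have hN'r : ((N' : ℕ) : ℝ) = (C : ℝ) * N := by rw [hN']; push_cast; ring
  obtain ⟨H, hH⟩ : ∃ H : ℕ, H = ⌈((N' : ℕ) : ℝ) ^ ((8 : ℝ) / 10)⌉₊ := ⟨_, rfl⟩
  have hKH : posBody Ψ (H : ℝ) K ⊆ realBox d N := (posBody_subset Ψ _ K).trans hKN
  -- Step 1: Thm. 4.5 for the extension `Ψ'` on the body `K'` at scale `N'`
  have h45 : |vonMangoldtSum (fun i => (Ψ i).extendAlong f)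
        (extBody f (N : ℝ) (posBody Ψ (H : ℝ) K)) N' -
      latticePointCount (extBody f (N : ℝ) (posBody Ψ (H : ℝ) K)) N' *
        singularProduct (fun i => (Ψ i).extendAlong f)| ≤
      ε / (4 * (C : ℝ) ^ (d + t * (s + 1))) * ((N' : ℕ) : ℝ) ^ (d + t * (s + 1)) := by
    refine hN₁ N' (hN₁N.trans hNN') _ (isNondegenerateSystem_extendAlong hΨ f)
      hnf ?_ _ (convex_extBody f N (convex_posBody Ψ (H : ℝ) hK)) ?_ ?_
    · rw [hL']
      exact affLinSize_extendAlong_le hNr0 (by exact_mod_cast hNN') hL hfM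
    · refine extBody_subset_realBox f hfM hNr0.le (le_of_eq ?_) hKH
      rw [hN'r, hC]
      push_cast
      ring
    · intro x hx i
      have hHc : ((N' : ℕ) : ℝ) ^ ((8 : ℝ) / 10) ≤ (H : ℝ) := by rw [hH]; exact Nat.le_ceil _
      exact lt_of_le_of_lt hHc (extendAlong_realEval_gt_of_mem_extBody f
        (fun y hy j => realEval_gt_of_mem_posBody hy j) hx i)
  -- Step 2: the change of variables `r := n + ∑ mₗ fₗ` and division by `(2N+1)^k`
  have hle : (1 + t * (s + 1) * M) * N ≤ N' := by rw [hN', hC]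
  rw [vonMangoldtSum_extendAlong_extBody Ψ f hfM hle hKH, latticePointCount_extBody f hfM hle hKH,
    singularProduct_extendAlong] at h45
  have hQ : (0 : ℝ) < (2 * (N : ℝ) + 1) ^ (t * (s + 1)) := by positivity
  have h2 : |vonMangoldtSum Ψ (posBody Ψ (H : ℝ) K) N -
      latticePointCount (posBody Ψ (H : ℝ) K) N * singularProduct Ψ| ≤ ε / 4 * (N : ℝ) ^ d := by
    refine le_of_mul_le_mul_left ?_ hQ
    have hlhs : (2 * (N : ℝ) + 1) ^ (t * (s + 1)) *
        |vonMangoldtSum Ψ (posBody Ψ (H : ℝ) K) N -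
          latticePointCount (posBody Ψ (H : ℝ) K) N * singularProduct Ψ| =
        |(2 * (N : ℝ) + 1) ^ (t * (s + 1)) * vonMangoldtSum Ψ (posBody Ψ (H : ℝ) K) N -
          (((2 * N + 1) ^ (t * (s + 1)) * latticePointCount (posBody Ψ (H : ℝ) K) N : ℕ) : ℝ) *
            singularProduct Ψ| := by
      rw [← abs_of_pos hQ, ← abs_mul, abs_of_pos hQ]
      congr 1
      push_cast
      ring
    rw [hlhs]
    refine h45.trans ?_
    rw [hN'r, mul_pow, pow_add (N : ℝ)]
    have hCpow : (C : ℝ) ^ (d + t * (s + 1)) ≠ 0 := by positivity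
    calc ε / (4 * (C : ℝ) ^ (d + t * (s + 1))) *
          ((C : ℝ) ^ (d + t * (s + 1)) * ((N : ℝ) ^ d * (N : ℝ) ^ (t * (s + 1))))
        = ε / 4 * (N : ℝ) ^ d * (N : ℝ) ^ (t * (s + 1)) := by
          field_simp
      _ ≤ ε / 4 * (N : ℝ) ^ d * (2 * (N : ℝ) + 1) ^ (t * (s + 1)) :=
          mul_le_mul_of_nonneg_left (pow_le_pow_left₀ hNr0.le (by linarith) _) (by positivity)
      _ = (2 * (N : ℝ) + 1) ^ (t * (s + 1)) * (ε / 4 * (N : ℝ) ^ d) := by ring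
  -- Step 3: the crude bounds (slab `0 < ψᵢ ≤ H`, lattice points vs volume)
  have e1 := vonMangoldtSum_sub_posBody_le hΨ hN1 hL₁ (hL.trans (le_max_left _ _)) K H
  have e3 : (latticePointCount (posBody Ψ 0 K) N : ℝ) ≤
      latticePointCount (posBody Ψ (H : ℝ) K) N + t * ((H : ℝ) * (2 * N + 1) ^ (d - 1)) := by
    exact_mod_cast latticePointCount_posBody_le hΨ K N H
  have e3' : (latticePointCount (posBody Ψ (H : ℝ) K) N : ℝ) ≤
      latticePointCount (posBody Ψ 0 K) N := by
    exact_mod_cast latticePointCount_mono (posBody_mono Ψ (Nat.cast_nonneg H) K) N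
  have e4 : |(latticePointCount (posBody Ψ 0 K) N : ℝ) - archFactor Ψ K| ≤ Cd * (N : ℝ) ^ (d - 1) :=
    hCd N hN1 (posBody Ψ 0 K) (convex_posBody Ψ 0 hK) ((posBody_subset Ψ 0 K).trans hKN)
  have hslab := hN₂ N hN₂N
  have hHG : (H : ℝ) ≤ (A * N) ^ ((8 : ℝ) / 10) + 1 := by
    have h1 : (H : ℝ) < ((N' : ℕ) : ℝ) ^ ((8 : ℝ) / 10) + 1 := by
      rw [hH]
      exact Nat.ceil_lt_add_one (by positivity)
    have h2 : ((N' : ℕ) : ℝ) ^ ((8 : ℝ) / 10) ≤ (A * N) ^ ((8 : ℝ) / 10) := by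
      refine Real.rpow_le_rpow (by positivity) ?_ (by norm_num)
      rw [hN'r]
      exact mul_le_mul_of_nonneg_right hCA hNr0.le
    linarith
  -- Step 4: bookkeeping
  have h2LN : (1 : ℝ) ≤ 2 * max (L : ℝ) 1 * N := by
    have := one_le_mul_of_one_le_of_one_le hL₁ hNr1
    linarith
  have hlog0 : 0 ≤ Real.log (2 * max (L : ℝ) 1 * N) := Real.log_nonneg h2LN
  have hΛLg : Real.log (2 * max (L : ℝ) 1 * N) ^ t ≤ (1 + Real.log (2 * max (L : ℝ) 1 * N)) ^ t :=
    pow_le_pow_left₀ hlog0 (by linarith) t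
  have hLg1 : 1 ≤ (1 + Real.log (2 * max (L : ℝ) 1 * N)) ^ t := one_le_pow₀ (by linarith)
  have hG1 : 1 ≤ (A * N) ^ ((8 : ℝ) / 10) + 1 := by
    have : 0 ≤ (A * N) ^ ((8 : ℝ) / 10) := Real.rpow_nonneg (by positivity) _
    linarith
  have hNP : (N : ℝ) ^ (d - 1) ≤ (2 * (N : ℝ) + 1) ^ (d - 1) :=
    pow_le_pow_left₀ hNr0.le (by linarith) _
  have hεN : 0 ≤ ε * (N : ℝ) ^ d := by positivity
  have key := archimedean_bookkeeping hS0 hSB hB0 e1.1 e1.2 h2 e3 e3' e4 hNP (by positivity) hHG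
    (Nat.cast_nonneg H) (by positivity) hA0 (Nat.cast_nonneg t) htA hCdA hΛLg hLg1 hG1 hslab
  linarith

/-- For `s ≥ 1`, Thm. 7.2 at level `s` alone (`GreenTao2010_gowersUniformityAt s`) gives the Main
Theorem for all systems of complexity `≤ s`, through the proved §7
(`GreenTao2010_wTrickedProduct_of_gowersUniformity_holds`), Thm. 5.2 ⇒ 5.1
(`GreenTao2010_wTricked_of_wTrickedProduct`), §5 (`GreenTao2010_mainNormalForm_of_wTricked_holds`)
and §4 at complexity `s`. [cite: GreenTao2010, Thm. 7.2, Thm. 5.2, Thm. 5.1, Thm. 4.5, §4] -/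
theorem GreenTao2010_mainTheoremAtComplexity_of_gowersUniformityAt {s : ℕ} (hs : 1 ≤ s)
    (h : GreenTao2010_gowersUniformityAt s) : GreenTao2010_mainTheoremAtComplexity s :=
  GreenTao2010_mainTheoremAtComplexity_of_mainNormalFormAt
    (GreenTao2010_mainNormalForm_of_wTricked_holds s hs
      (GreenTao2010_wTricked_of_wTrickedProduct s
        (GreenTao2010_wTrickedProduct_of_gowersUniformity_holds s hs h)))

/-- **The Main Theorem of Green–Tao 2010 for every system of complexity at most one,
unconditionally (in this tree)**: for every `d ≥ 1`, `t ≥ 1`, `L` and `ε > 0` there is `N₀` such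
that for `N ≥ N₀`, every nondegenerate system `Ψ` of `t` affine-linear forms in `d` variables of
Cauchy–Schwarz complexity `≤ 1` with `‖Ψ‖_N ≤ L` and every convex `K ⊆ [−N, N]^d`,
`|∑_{n ∈ K ∩ ℤ^d} ∏ᵢ Λ(ψᵢ(n)) − β_∞ ∏_p β_p| ≤ ε N^d` — e.g. Balog's systems
`(nᵢ + nⱼ + 1)_{1 ≤ i ≤ j ≤ d}` (Example 4), prime two-dimensional cubes (Example 2, `d = 3`), one
linear equation in `t ≥ 3` primes. From Thm. 4.5 at `s = 1` (`GreenTao2010_mainNormalFormAt_one`,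
itself from the unconditional `U²` estimate `GreenTao2010_gowersUniformityAt_one`) and §4 at
complexity `1`. [cite: GreenTao2010, Main Theorem (case of complexity `≤ 1`), Examples 2 and 4,
p. 6 ("For systems of complexity 1, the conjecture can be treated by the Hardy–Littlewood circle
method")] -/
theorem GreenTao2010_mainTheoremAtComplexity_one : GreenTao2010_mainTheoremAtComplexity 1 :=
  GreenTao2010_mainTheoremAtComplexity_of_mainNormalFormAt GreenTao2010_mainNormalFormAt_one

/-- The level `s = 0` ("for systems of complexity 0, the generalised Hardy–Littlewood conjecture
follows easily from the prime number theorem in APs"), as a special case of the level `1`.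
[cite: GreenTao2010, p. 6] -/
theorem GreenTao2010_mainTheoremAtComplexity_zero : GreenTao2010_mainTheoremAtComplexity 0 :=
  GreenTao2010_mainTheoremAtComplexity_one.anti zero_le_one

/-- The level `s = 2` from Thm. 7.2 at `s = 2` (the `U³`-uniformity of `Λ'_{b,W} − 1`, i.e. the
`2`-step inputs `GI(2)`, `MN(2)` of Green–Tao 2010, §1): every system of complexity `≤ 2`, e.g.
four-term progressions and three-dimensional cubes. [cite: GreenTao2010, Thm. 7.2 (case `s = 2`),
Examples 1 and 2] -/
theorem GreenTao2010_mainTheoremAtComplexity_two_of_gowersUniformityAt_two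
    (h : GreenTao2010_gowersUniformityAt 2) : GreenTao2010_mainTheoremAtComplexity 2 :=
  GreenTao2010_mainTheoremAtComplexity_of_gowersUniformityAt (by norm_num) h

/-! ### On-path certificates -/

/-- `GeneralizedHardyLittlewood` (Thm. 1.2 without any complexity hypothesis) implies every
level (drop the complexity hypothesis). [cite: GreenTao2010, Conj. 1.2 ⊇ Main Theorem] -/
theorem GeneralizedHardyLittlewood.mainTheoremAtComplexity (h : GeneralizedHardyLittlewood)
    (s : ℕ) : GreenTao2010_mainTheoremAtComplexity s := by
  intro d t L hd ht ε hε
  obtain ⟨N₀, hN₀⟩ := h d t L hd ht ε hε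
  exact ⟨N₀, fun N hN Ψ hΨ _ hL K hK hKN => hN₀ N hN Ψ hΨ hL K hK hKN⟩

/-- The finite-complexity Main Theorem implies every level: complexity `≤ s < ∞` forces that no
two linear parts are parallel (Lemma 1.6, `isFiniteComplexitySystem_of_complexity_ne_top`).
[cite: GreenTao2010, Lemma 1.6] -/
theorem GreenTaoZiegler2012_finiteComplexity.mainTheoremAtComplexity
    (h : GreenTaoZiegler2012_finiteComplexity) (s : ℕ) : GreenTao2010_mainTheoremAtComplexity s := by
  intro d t L hd ht ε hε
  obtain ⟨N₀, hN₀⟩ := h d t L hd ht ε hε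
  exact ⟨N₀, fun N hN Ψ hΨ hc hL K hK hKN => hN₀ N hN Ψ hΨ
    (isFiniteComplexitySystem_of_complexity_ne_top (ne_top_of_le_ne_top (ENat.coe_ne_top s) hc)).1
    hL K hK hKN⟩

/-- Conversely the levels exhaust the finite-complexity Main Theorem: a nondegenerate system of
`t` forms with no two linear parts parallel has complexity `≤ t − 2` (Lemma 1.6,
`complexity_le_of_isFiniteComplexitySystem`), so the level `t − 2` applies.
[cite: GreenTao2010, Lemma 1.6] -/
theorem GreenTaoZiegler2012_finiteComplexity_of_forall_mainTheoremAtComplexity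
    (h : ∀ s, GreenTao2010_mainTheoremAtComplexity s) : GreenTaoZiegler2012_finiteComplexity := by
  intro d t L hd ht ε hε
  obtain ⟨N₀, hN₀⟩ := h (t - 2) d t L hd ht ε hε
  exact ⟨N₀, fun N hN Ψ hΨ hfc hL K hK hKN => hN₀ N hN Ψ hΨ
    (complexity_le_of_isFiniteComplexitySystem hfc hΨ.1) hL K hK hKN⟩

/-- **Census**: the family `GreenTao2010_mainTheoremAtComplexity s`, `s ∈ ℕ`, is exactly the
finite-complexity Main Theorem `GreenTaoZiegler2012_finiteComplexity`; the tree proves the levels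
`s ≤ 1` and reduces each level `s ≥ 2` to `GreenTao2010_gowersUniformityAt s`.
[cite: GreenTao2010, Main Theorem and Lemma 1.6] -/
theorem greenTaoZiegler2012_finiteComplexity_iff_forall_mainTheoremAtComplexity :
    GreenTaoZiegler2012_finiteComplexity ↔ ∀ s, GreenTao2010_mainTheoremAtComplexity s :=
  ⟨fun h s => h.mainTheoremAtComplexity s,
    GreenTaoZiegler2012_finiteComplexity_of_forall_mainTheoremAtComplexity⟩

end Literature.NumberTheory.Sieve
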